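import Summits.QuantumFields.YangMills.Theorems.BalabanUVNodesPortU8LiftWindow

/-!
# PORT PT-B (U8), g3 file 5 — THE FINE REGION OVER THE NO-WRAP WINDOW AS AN INTEGER BOX: `Reg_j(z₀, R) = {Φ z : (z₀ − R)·M − j ≤ z ≤ (z₀ + R + 1)·M − 1 + j}`
# (`M = L^{k+1}`; `Reg_0` = the fine sites whose `(k+1)`-block lies in `recordWindow R z₀`), its centredness under `NoWrapAt` (`j ≤ M`), closure under unit steps, and the
# CENTRED LIFT on it: `lift (Φ_K z) = Φ_{K+1} z`, commuting with `± e_μ`; the region of the LIFTED window is the lift of the region — third geometric part of (R4ᴰ-Loc)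

Cell `ym-nodeO-ideate` ∕ `ym-balaban-port`, porter `ymgap-nodeO-port-PTB-1` (gen 3), item **stmt-QuantumFields-27931** `BalabanUVNodes.PortPieceLocalityU8`
(text ⁷⁗ «v10-Loc» `d796c7a1386a82f1`).  `--supports stmt-QuantumFields-27931` (helper).  [I] = [Balaban1987RG1], [B6] = [Balaban1984PropagatorsII].

WHAT THIS FILE PROVES (theorems only; no `def ∕ instance ∕ notation ∕ sorry`; standard axioms; the box predicate is written inline):
* §1 `two_mul_abs_lt_of_inBox` (box labels with `j ≤ M` are strictly centred under `NoWrapAt R z₀`), `inBox_mono`, `inBox_add_single ∕ _sub_single` (a unit step costs one unit of margin);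
* §2 ★ `iterBlockOf_siteOfInt_mem_recordWindow_iff` (for weakly centred `z`: the block of `Φ z` lies in the window iff `z ∈ Reg_0`), `exists_inBox_of_iterBlockOf_mem` (every fine site over
  the window is `Φ z`, `z ∈ Reg_0`), and the same in the bigger volume with the SAME box (`exists_inBox_of_iterBlockOf_mem_succ`);
* §3 the lift on the box: `liftSiteCtr_siteOfInt_of_inBox`, `liftSiteCtr_shift_of_inBox ∕ _unshift_of_inBox`, `iterBlockOf_liftSiteCtr_mem_iff` (the block of `lift s` lies in the lifted
  window iff the block of `s` lies in the window — for EVERY fine site `s`), `exists_eq_lift_of_iterBlockOf_mem_succ`.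
HONEST FRAMING.  Lattice bookkeeping; nothing of Bałaban asserted∕ported∕discharged; 27931 OPEN · SIGNED v10-Loc · close HOLD (№495); K0⁷ OPEN; NODE O 0∕1; COUNT 8∕28 · K 1∕4
UNMOVED; finite `𝕋⁴_{L^K}` at fixed ε — NOT continuum ∕ OS ∕ Clay; **the Yang–Mills mass gap (Clay) is NOT proved by any of this.**
-/

noncomputable section

namespace Summit.QuantumFields.YangMills.Theorems.PortU8

open Literature.MathematicalPhysics.QuantumFieldTheory.Balaban1983to89
open Literature.MathematicalPhysics.QuantumFieldTheory.Balaban1983to89.Node00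
open Literature.MathematicalPhysics.QuantumFieldTheory.Balaban1983to89.T4Continuum (T4Family)
open Literature.MathematicalPhysics.QuantumFieldTheory.Balaban1983to89.B5Eq118OneStroke (iterBlockOf iterBlock)
open Summit.QuantumFields.YangMills.Theorems.K0RecordFormatNames

variable (F : T4Family)

/-! ## §1  The integer box `Reg_j(z₀, R)`: centredness and closure under unit steps -/

/-- ★ **BOX LABELS ARE STRICTLY CENTRED** under `NoWrapAt R z₀`, as long as the fine margin `j` is at most one block `M = L^{k+1}`:
`(z₀ i − R)·M − j ≤ z i ≤ (z₀ i + R + 1)·M − 1 + j ⇒ 2|z i| < N_0`. [cite: Balaban1987RG1, (1.21) p.264 (bookkeeping)] -/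
theorem two_mul_abs_lt_of_inBox {k K R : ℕ} {z₀ : Fin 4 → ℤ} (hk : k + 1 ≤ F.m + K) (hnw : NoWrapAt F k K R z₀) {j : ℕ} (hj : (j : ℤ) ≤ (F.L : ℤ) ^ (k + 1))
    {z : Fin 4 → ℤ} (hz : ∀ i, (z₀ i - R) * (F.L : ℤ) ^ (k + 1) - j ≤ z i ∧ z i ≤ (z₀ i + R + 1) * (F.L : ℤ) ^ (k + 1) - 1 + j) (i : Fin 4) :
    2 * |z i| < ((F.P K).sitesPerDir 0 : ℤ) := by
  set M : ℤ := (F.L : ℤ) ^ (k + 1) with hM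
  have hM0 : 0 < M := by have := (F.P K).L_pos; positivity
  have hN0 : ((F.P K).sitesPerDir 0 : ℤ) = M * (F.P K).sitesPerDir (k + 1) := sitesPerDir_zero_eq_pow_mul F K (k + 1) hk
  have hw := hnw i
  obtain ⟨h1, h2⟩ := hz i
  -- `|z₀ i| + R + 1 ≤ N∕2 - 1∕2`, i.e. `2(|z₀ i| + R + 1) + 1 ≤ N`; with `N` even in fact `+2 ≤ N`
  have hev : (2 : ℤ) ∣ ((F.P K).sitesPerDir (k + 1) : ℤ) :=
    ⟨(F.L : ℤ) ^ (F.m + K - (k + 1)), by rw [show (F.P K).sitesPerDir (k + 1) = 2 * F.L ^ (F.m + K - (k + 1)) from rfl]; push_cast; ring⟩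
  obtain ⟨h, hh⟩ := hev
  rw [hh] at hw hN0
  have hb : |z₀ i| + R + 2 ≤ h := by omega
  have e1 : (z₀ i + R + 1) * M ≤ (h - 1) * M := mul_le_mul_of_nonneg_right (by linarith [le_abs_self (z₀ i)]) hM0.le
  have e2 : (-(h - 2)) * M ≤ (z₀ i - R) * M := mul_le_mul_of_nonneg_right (by linarith [neg_abs_le (z₀ i)]) hM0.le
  have key : |z i| < M * h := by
    rw [abs_lt]; constructor <;> nlinarith
  rw [hN0]; linarith

/-- The box grows with the margin. [folklore] -/
theorem inBox_mono {k R : ℕ} {z₀ : Fin 4 → ℤ} {j j' : ℕ} (hjj : j ≤ j') {z : Fin 4 → ℤ}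
    (hz : ∀ i, (z₀ i - R) * (F.L : ℤ) ^ (k + 1) - j ≤ z i ∧ z i ≤ (z₀ i + R + 1) * (F.L : ℤ) ^ (k + 1) - 1 + j) (i : Fin 4) :
    (z₀ i - R) * (F.L : ℤ) ^ (k + 1) - j' ≤ z i ∧ z i ≤ (z₀ i + R + 1) * (F.L : ℤ) ^ (k + 1) - 1 + j' := by
  have := hz i; have : (j : ℤ) ≤ j' := by exact_mod_cast hjj
  constructor <;> linarith [(hz i).1, (hz i).2]

/-- A unit step `+e_μ` costs one unit of margin. [folklore] -/
theorem inBox_add_single {k R : ℕ} {z₀ : Fin 4 → ℤ} {j : ℕ} {z : Fin 4 → ℤ} (μ : Fin 4)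
    (hz : ∀ i, (z₀ i - R) * (F.L : ℤ) ^ (k + 1) - j ≤ z i ∧ z i ≤ (z₀ i + R + 1) * (F.L : ℤ) ^ (k + 1) - 1 + j) (i : Fin 4) :
    (z₀ i - R) * (F.L : ℤ) ^ (k + 1) - (j + 1 : ℕ) ≤ (z + Pi.single μ (1 : ℤ) : Fin 4 → ℤ) i ∧ (z + Pi.single μ (1 : ℤ) : Fin 4 → ℤ) i ≤ (z₀ i + R + 1) * (F.L : ℤ) ^ (k + 1) - 1 + (j + 1 : ℕ) := by
  obtain ⟨h1, h2⟩ := hz i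
  rw [Pi.add_apply]
  by_cases h : i = μ
  · subst h; rw [Pi.single_eq_same]; push_cast; constructor <;> linarith
  · rw [Pi.single_eq_of_ne h]; push_cast; constructor <;> linarith

/-- A unit step `−e_μ` costs one unit of margin. [folklore] -/
theorem inBox_sub_single {k R : ℕ} {z₀ : Fin 4 → ℤ} {j : ℕ} {z : Fin 4 → ℤ} (μ : Fin 4)
    (hz : ∀ i, (z₀ i - R) * (F.L : ℤ) ^ (k + 1) - j ≤ z i ∧ z i ≤ (z₀ i + R + 1) * (F.L : ℤ) ^ (k + 1) - 1 + j) (i : Fin 4) :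
    (z₀ i - R) * (F.L : ℤ) ^ (k + 1) - (j + 1 : ℕ) ≤ (z - Pi.single μ (1 : ℤ) : Fin 4 → ℤ) i ∧ (z - Pi.single μ (1 : ℤ) : Fin 4 → ℤ) i ≤ (z₀ i + R + 1) * (F.L : ℤ) ^ (k + 1) - 1 + (j + 1 : ℕ) := by
  obtain ⟨h1, h2⟩ := hz i
  rw [Pi.sub_apply]
  by_cases h : i = μ
  · subst h; rw [Pi.single_eq_same]; push_cast; constructor <;> linarith
  · rw [Pi.single_eq_of_ne h]; push_cast; constructor <;> linarith

/-! ## §2  `Reg_0` IS the set of fine sites over the window -/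

/-- Floor division lands in `[a, b]` iff the label lies in `[a·M, (b+1)·M − 1]` (`M > 0`). [folklore] -/
theorem ediv_mem_Icc_iff {w a b M : ℤ} (hM : 0 < M) : (a ≤ w / M ∧ w / M ≤ b) ↔ (a * M ≤ w ∧ w ≤ (b + 1) * M - 1) := by
  rw [Int.le_ediv_iff_mul_le hM]
  have : w / M ≤ b ↔ w ≤ (b + 1) * M - 1 := by
    rw [← Int.lt_add_one_iff, Int.ediv_lt_iff_lt_mul hM]; omega
  rw [this]

/-- ★ **THE BLOCK OF `Φ z` LIES IN THE WINDOW IFF `z ∈ Reg_0`** (no-reach radius `2(|z₀ i| + R) < N_{k+1}`, `2|z i| ≤ N_0`, standing range).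
[cite: Balaban1987RG1, (1.21) p.264, p.274 L8–9 (bookkeeping)] -/
theorem iterBlockOf_siteOfInt_mem_recordWindow_iff {k K R : ℕ} (hk : k + 1 ≤ F.m + K) {z₀ : Fin 4 → ℤ}
    (hc : ∀ i, 2 * (|z₀ i| + R) < ((F.P K).sitesPerDir (k + 1) : ℤ)) {z : Fin 4 → ℤ} (hz2 : ∀ i, 2 * |z i| ≤ ((F.P K).sitesPerDir 0 : ℤ)) :
    iterBlockOf (k + 1) (siteOfInt F K 0 z) ∈ recordWindow F k K R z₀ ↔
      ∀ i, (z₀ i - R) * (F.L : ℤ) ^ (k + 1) - (0 : ℕ) ≤ z i ∧ z i ≤ (z₀ i + R + 1) * (F.L : ℤ) ^ (k + 1) - 1 + (0 : ℕ) := by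
  have hkK : k + 1 ≤ (F.P K).m + (F.P K).K := by simpa using hk
  have hM0 : (0 : ℤ) < (F.L : ℤ) ^ (k + 1) := by have := (F.P K).L_pos; positivity
  rw [iterBlockOf_siteOfInt F K (k + 1) hkK z, mem_recordWindow_siteOfInt_iff F k K R z₀ _ hc fun i => two_mul_abs_ediv_pow_le F K (k + 1) hk (hz2 i)]
  refine forall_congr' fun i => ?_
  rw [abs_le, show -(R : ℤ) ≤ z i / (F.L : ℤ) ^ (k + 1) - z₀ i ∧ z i / (F.L : ℤ) ^ (k + 1) - z₀ i ≤ R ↔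
      z₀ i - R ≤ z i / (F.L : ℤ) ^ (k + 1) ∧ z i / (F.L : ℤ) ^ (k + 1) ≤ z₀ i + R by constructor <;> rintro ⟨h1, h2⟩ <;> constructor <;> linarith,
    ediv_mem_Icc_iff hM0]
  push_cast; simp only [sub_zero, add_zero]

/-- ★ **EVERY FINE SITE OVER THE WINDOW IS `Φ z` WITH `z ∈ Reg_0`** (its least-absolute-value coordinates). [cite: Balaban1987RG1, (1.21) p.264 (bookkeeping)] -/
theorem exists_inBox_of_iterBlockOf_mem {k K R : ℕ} (hk : k + 1 ≤ F.m + K) {z₀ : Fin 4 → ℤ}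
    (hc : ∀ i, 2 * (|z₀ i| + R) < ((F.P K).sitesPerDir (k + 1) : ℤ)) {s : Site (F.P K) 0} (hs : iterBlockOf (k + 1) s ∈ recordWindow F k K R z₀) :
    ∃ z : Fin 4 → ℤ, siteOfInt F K 0 z = s ∧ ∀ i, (z₀ i - R) * (F.L : ℤ) ^ (k + 1) - (0 : ℕ) ≤ z i ∧ z i ≤ (z₀ i + R + 1) * (F.L : ℤ) ^ (k + 1) - 1 + (0 : ℕ) := by
  refine ⟨fun i => ((s (Fin.cast (F.P_d K).symm i)).valMinAbs : ℤ), siteOfInt_valMinAbs F K 0 s, ?_⟩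
  rw [← iterBlockOf_siteOfInt_mem_recordWindow_iff F hk hc fun i => two_mul_abs_valMinAbs_le F K 0 s _, siteOfInt_valMinAbs]
  exact hs

/-- The same in the BIGGER volume with the SAME box: every fine site of `T_{K+1}` over the lifted window is `Φ_{K+1} z` with `z ∈ Reg_0(z₀, R)`.
[cite: Balaban1987RG1, (1.21) p.264 (bookkeeping)] -/
theorem exists_inBox_of_iterBlockOf_mem_succ {k K R : ℕ} (hk : k + 1 ≤ F.m + K) {z₀ : Fin 4 → ℤ}
    (hc : ∀ i, 2 * (|z₀ i| + R) < ((F.P K).sitesPerDir (k + 1) : ℤ)) {s' : Site (F.P (K + 1)) 0} (hs : iterBlockOf (k + 1) s' ∈ recordWindow F k (K + 1) R z₀) :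
    ∃ z : Fin 4 → ℤ, siteOfInt F (K + 1) 0 z = s' ∧ ∀ i, (z₀ i - R) * (F.L : ℤ) ^ (k + 1) - (0 : ℕ) ≤ z i ∧ z i ≤ (z₀ i + R + 1) * (F.L : ℤ) ^ (k + 1) - 1 + (0 : ℕ) := by
  have hle : ((F.P K).sitesPerDir (k + 1) : ℤ) ≤ (F.P (K + 1)).sitesPerDir (k + 1) := by exact_mod_cast sitesPerDir_le_succ_vol F K (k + 1) hk
  exact exists_inBox_of_iterBlockOf_mem F (K := K + 1) (by omega) (fun i => lt_of_lt_of_le (hc i) hle) hs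

/-! ## §3  The centred lift on the box -/

/-- On the box (margin `j ≤ M`) the lift is «same integer coordinates»: `lift (Φ_K z) = Φ_{K+1} z`. [cite: Balaban1987RG1, (1.21) p.264] -/
theorem liftSiteCtr_siteOfInt_of_inBox {k K R : ℕ} {z₀ : Fin 4 → ℤ} (hk : k + 1 ≤ F.m + K) (hnw : NoWrapAt F k K R z₀) {j : ℕ} (hj : (j : ℤ) ≤ (F.L : ℤ) ^ (k + 1))
    {z : Fin 4 → ℤ} (hz : ∀ i, (z₀ i - R) * (F.L : ℤ) ^ (k + 1) - j ≤ z i ∧ z i ≤ (z₀ i + R + 1) * (F.L : ℤ) ^ (k + 1) - 1 + j) :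
    liftSiteCtr F K 0 (siteOfInt F K 0 z) = siteOfInt F (K + 1) 0 z :=
  liftSiteCtr_siteOfInt F K 0 z fun i => mem_Ioc_of_two_mul_abs_lt (two_mul_abs_lt_of_inBox F hk hnw hj hz i)

/-- ★ On the box with one unit of margin to spare (`j + 1 ≤ M`) the lift commutes with `+e_μ`. [cite: Balaban1987RG1, (1.21) p.264] -/
theorem liftSiteCtr_shift_of_inBox {k K R : ℕ} {z₀ : Fin 4 → ℤ} (hk : k + 1 ≤ F.m + K) (hnw : NoWrapAt F k K R z₀) {j : ℕ} (hj : (j : ℤ) + 1 ≤ (F.L : ℤ) ^ (k + 1))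
    {z : Fin 4 → ℤ} (hz : ∀ i, (z₀ i - R) * (F.L : ℤ) ^ (k + 1) - j ≤ z i ∧ z i ≤ (z₀ i + R + 1) * (F.L : ℤ) ^ (k + 1) - 1 + j) (μ : Fin (F.P K).d) :
    liftSiteCtr F K 0 ((siteOfInt F K 0 z).shift μ) = (siteOfInt F (K + 1) 0 z).shift μ := by
  have h1 := liftSiteCtr_shift_of F K 0 z μ (fun i => mem_Ioc_of_two_mul_abs_lt (two_mul_abs_lt_of_inBox F hk hnw (by linarith) hz i))
    (fun i => mem_Ioc_of_two_mul_abs_lt (two_mul_abs_lt_of_inBox F hk hnw (j := j + 1) (by push_cast; linarith) (inBox_add_single F (Fin.cast (F.P_d K) μ) hz) i))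
  rw [h1, liftSiteCtr_siteOfInt_of_inBox F hk hnw (by linarith) hz]

/-- ★ On the box with one unit of margin to spare the lift commutes with `−e_μ`. [cite: Balaban1987RG1, (1.21) p.264] -/
theorem liftSiteCtr_unshift_of_inBox {k K R : ℕ} {z₀ : Fin 4 → ℤ} (hk : k + 1 ≤ F.m + K) (hnw : NoWrapAt F k K R z₀) {j : ℕ} (hj : (j : ℤ) + 1 ≤ (F.L : ℤ) ^ (k + 1))
    {z : Fin 4 → ℤ} (hz : ∀ i, (z₀ i - R) * (F.L : ℤ) ^ (k + 1) - j ≤ z i ∧ z i ≤ (z₀ i + R + 1) * (F.L : ℤ) ^ (k + 1) - 1 + j) (μ : Fin (F.P K).d) :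
    liftSiteCtr F K 0 ((siteOfInt F K 0 z).unshift μ) = (siteOfInt F (K + 1) 0 z).unshift μ := by
  have h1 := liftSiteCtr_unshift_of F K 0 z μ (fun i => mem_Ioc_of_two_mul_abs_lt (two_mul_abs_lt_of_inBox F hk hnw (by linarith) hz i))
    (fun i => mem_Ioc_of_two_mul_abs_lt (two_mul_abs_lt_of_inBox F hk hnw (j := j + 1) (by push_cast; linarith) (inBox_sub_single F (Fin.cast (F.P_d K) μ) hz) i))
  rw [h1, liftSiteCtr_siteOfInt_of_inBox F hk hnw (by linarith) hz]

/-- ★★ **THE BLOCK OF `lift s` LIES IN THE LIFTED WINDOW IFF THE BLOCK OF `s` LIES IN THE WINDOW** — for EVERY fine site `s` (`NoWrapAt R z₀`, standing range).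
[cite: Balaban1987RG1, (1.21) p.264] -/
theorem iterBlockOf_liftSiteCtr_mem_iff {k K R : ℕ} {z₀ : Fin 4 → ℤ} (hk : k + 1 ≤ F.m + K) (hnw : NoWrapAt F k K R z₀) (s : Site (F.P K) 0) :
    iterBlockOf (k + 1) (liftSiteCtr F K 0 s) ∈ recordWindow F k (K + 1) R z₀ ↔ iterBlockOf (k + 1) s ∈ recordWindow F k K R z₀ := by
  have hc : ∀ i, 2 * (|z₀ i| + R) < ((F.P K).sitesPerDir (k + 1) : ℤ) := fun i => NoWrapAt.two_mul_lt F hnw (Nat.le_succ R) i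
  have hle : ((F.P K).sitesPerDir (k + 1) : ℤ) ≤ (F.P (K + 1)).sitesPerDir (k + 1) := by exact_mod_cast sitesPerDir_le_succ_vol F K (k + 1) hk
  have hle0 : ((F.P K).sitesPerDir 0 : ℤ) ≤ (F.P (K + 1)).sitesPerDir 0 := by exact_mod_cast sitesPerDir_le_succ_vol F K 0 (Nat.zero_le _)
  have hc' : ∀ i, 2 * (|z₀ i| + R) < ((F.P (K + 1)).sitesPerDir (k + 1) : ℤ) := fun i => lt_of_lt_of_le (hc i) hle
  set z : Fin 4 → ℤ := fun i => ((s (Fin.cast (F.P_d K).symm i)).valMinAbs : ℤ) with hzdef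
  have hsz : siteOfInt F K 0 z = s := siteOfInt_valMinAbs F K 0 s
  have hz2 : ∀ i, 2 * |z i| ≤ ((F.P K).sitesPerDir 0 : ℤ) := fun i => two_mul_abs_valMinAbs_le F K 0 s _
  rw [liftSiteCtr_eq_siteOfInt, iterBlockOf_siteOfInt_mem_recordWindow_iff F (K := K + 1) (by omega) hc' fun i => (hz2 i).trans hle0]
  conv_rhs => rw [← hsz, iterBlockOf_siteOfInt_mem_recordWindow_iff F hk hc hz2]

/-- ★ **EVERY FINE SITE OF `T_{K+1}` OVER THE LIFTED WINDOW IS A LIFT** of a fine site of `T_K` over the window. [cite: Balaban1987RG1, (1.21) p.264] -/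
theorem exists_eq_lift_of_iterBlockOf_mem_succ {k K R : ℕ} {z₀ : Fin 4 → ℤ} (hk : k + 1 ≤ F.m + K) (hnw : NoWrapAt F k K R z₀) {s' : Site (F.P (K + 1)) 0}
    (hs : iterBlockOf (k + 1) s' ∈ recordWindow F k (K + 1) R z₀) :
    ∃ s : Site (F.P K) 0, iterBlockOf (k + 1) s ∈ recordWindow F k K R z₀ ∧ liftSiteCtr F K 0 s = s' := by
  have hc : ∀ i, 2 * (|z₀ i| + R) < ((F.P K).sitesPerDir (k + 1) : ℤ) := fun i => NoWrapAt.two_mul_lt F hnw (Nat.le_succ R) i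
  obtain ⟨z, hzs, hz⟩ := exists_inBox_of_iterBlockOf_mem_succ F hk hc hs
  have hM : ((0 : ℕ) : ℤ) ≤ (F.L : ℤ) ^ (k + 1) := by have := (F.P K).L_pos; positivity
  refine ⟨siteOfInt F K 0 z, ?_, ?_⟩
  · rw [iterBlockOf_siteOfInt_mem_recordWindow_iff F hk hc fun i => (two_mul_abs_lt_of_inBox F hk hnw hM hz i).le]; exact hz
  · rw [liftSiteCtr_siteOfInt_of_inBox F hk hnw hM hz, hzs]

end Summit.QuantumFields.YangMills.Theorems.PortU8

end
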